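import Summits.BirchSwinnertonDyer.BirchSwinnertonDyer.Theorems.SignedLowerHalvesSmallImageLowerHalfBothSignsRttCharRoadJGluePrep
import Literature.NumberTheory.EllipticCurves.GreenbergSelmerDualDataExistsProofs
import HarnessLib

/-!
# Route `SignedLowerHalves`, crux L `SmallImageLowerHalfBothSigns` (item stmt-BirchSwinnertonDyer-23599), line `rtt_w3` v8 —
# row J-glue, steps M2–M4: the transport `j = (f₀ mod 𝒪) ∘ α` from a local embedding `f₀ : K_v → ℚ̄_p` with values in `ℚ_p(S)`,
# its equivariance and its `𝒪`-span

LEAD `cruxlead-stmt-BirchSwinnertonDyer-23599` g5; helper `--supports stmt-BirchSwinnertonDyer-23599`; THEOREMS ONLY, no `sorry`; closes nothing;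
BSD / crux L / J are not proved by this.

J-GLUE (spec `Cruxes/…/Lines/rtt_w3_JGLUE_spec.lean`, plan BRIEF-v8-g5 §6): from the curve side `α : W[p^∞] ≃ K_v/𝒪_{K_v}` (`χW`-equivariant) and
a continuous embedding `f₀ : K_v → ℚ̄_p` over `σK` with `f₀(K_v) ⊆ ℚ_p(S)`, `f₀(𝒪_{K_v}) ⊆ 𝒪_{ℚ_p(S)}` (step M1, separate), the datum `j` of JD is
`j = f̄₀ ∘ α` with `f̄₀ : K_v/𝒪_{K_v} → (F/𝒪)(θ) = Cofree θ F`, `x mod 𝒪 ↦ (f₀ x) mod 𝒪`. This file (membership as HYPOTHESES `hF`, `hO`):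
* `exists_transportHom` (M2) — `f̄₀` exists as an additive map with `f̄₀(x mod 𝒪) = cofreeMk (f₀ x)`; `transportHom_smul` — it is `f₀`-semilinear:
  `f̄₀(c • q) = f₀(c) • f̄₀(q)` for `c ∈ 𝒪_{K_v}`;
* `transport_equivariant` (M3) — if `α(res δ • t) = χW(δ) • α(t)` and `θ(res δ)₀₀ = f₀(χW δ)` (the character identification of
  `…JGlueCharId.theta_res_eq_of_weil`) then `j(res δ • t) = res δ • j(t)` (`smul_cofreeMk_of_rank_one`);
* `span_range_transport_eq_top` (M4) — if `α` is surjective then the `𝒪_{ℚ_p(S)}`-span of the range of `j` is everything (`p^{-k} mod 𝒪` is hit).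

References: [EmertonPollackWeston2006] §3.1; [Greenberg1989] §1 p. 98.
-/

set_option autoImplicit false
-- D-0017: single-problem summit, the namespace repeats the problem name by design.
set_option linter.dupNamespace false
noncomputable section

open scoped NumberField MatrixGroups
open NumberField IsDedekindDomain Field
  Literature.NumberTheory.GaloisRepresentations Literature.NumberTheory.EllipticCurves

namespace Summit.BirchSwinnertonDyer.BirchSwinnertonDyer.Theorems.SmallImageRttCharRoad

section Transport

variable {K : Type} [Field K] [NumberField K] {p : ℕ} [Fact p.Prime] {S : Set (PadicAlgCl p)}
  (θ : FramedGaloisRep K (padicCoeffIntegers S) 1) {v : HeightOneSpectrum (𝓞 K)}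
  (f₀ : v.adicCompletion K →+* PadicAlgCl p)
  (hF : ∀ x : v.adicCompletion K, f₀ x ∈ padicCoeffField S)

/-- The vector `(f₀ x) ∈ F¹`, `F = ℚ_p(S)` (constant on `Fin 1`). [folklore] -/
theorem transportVec_add (x y : v.adicCompletion K) :
    (fun _ : Fin 1 => (⟨f₀ (x + y), hF (x + y)⟩ : padicCoeffField S)) =
      (fun _ : Fin 1 => (⟨f₀ x, hF x⟩ : padicCoeffField S)) + fun _ : Fin 1 => (⟨f₀ y, hF y⟩ : padicCoeffField S) := by
  funext i
  apply Subtype.ext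
  simp only [Pi.add_apply, map_add]
  rfl

/-- For `y ∈ 𝒪_{K_v}` the vector `(f₀ y)` lies in the lattice `𝒪¹ ⊆ F¹` (`f₀(𝒪_{K_v}) ⊆ 𝒪_{ℚ_p(S)}`). [cite: Greenberg1989, §1 p. 98] -/
theorem transportVec_mem_lattice (hO : ∀ y : v.adicCompletionIntegers K, f₀ (y : v.adicCompletion K) ∈ padicCoeffIntegers S)
    (y : v.adicCompletionIntegers K) :
    (fun _ : Fin 1 => (⟨f₀ (y : v.adicCompletion K), hF y⟩ : padicCoeffField S)) ∈
      GreenbergSelmer.lattice 1 (padicCoeffIntegers S) (padicCoeffField S) := by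
  rw [GreenbergSelmer.mem_lattice_iff]
  refine ⟨fun _ => ⟨f₀ (y : v.adicCompletion K), hO y⟩, ?_⟩
  funext i
  apply Subtype.ext
  rfl

/-- **M2: the transport map `f̄₀ : K_v/𝒪_{K_v} → (F/𝒪)(θ)`, `x mod 𝒪 ↦ (f₀ x) mod 𝒪`, exists** (additive; well defined because `f₀(𝒪_{K_v}) ⊆ 𝒪`).
[cite: EmertonPollackWeston2006, §3.1 (arXiv:math/0404484 p. 17)] -/
theorem exists_transportHom (hO : ∀ y : v.adicCompletionIntegers K, f₀ (y : v.adicCompletion K) ∈ padicCoeffIntegers S) :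
    ∃ fb : (v.adicCompletion K ⧸ Submodule.span (v.adicCompletionIntegers K) {(1 : v.adicCompletion K)}) →+
        GreenbergSelmer.Cofree θ (padicCoeffField S),
      ∀ x : v.adicCompletion K,
        fb (Submodule.Quotient.mk x) = GreenbergSelmer.cofreeMk (padicCoeffField S) θ (fun _ => ⟨f₀ x, hF x⟩) := by
  -- the additive map `x ↦ (f₀ x) mod 𝒪` on `K_v`
  let g : v.adicCompletion K →+ GreenbergSelmer.Cofree θ (padicCoeffField S) :=
    { toFun := fun x => GreenbergSelmer.cofreeMk (padicCoeffField S) θ (fun _ => ⟨f₀ x, hF x⟩)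
      map_zero' := by
        have h0 : (fun _ : Fin 1 => (⟨f₀ 0, hF 0⟩ : padicCoeffField S)) = 0 := by
          funext i; apply Subtype.ext; simp only [map_zero, Pi.zero_apply]; rfl
        rw [h0, map_zero]
      map_add' := fun x y => by rw [transportVec_add f₀ hF, map_add] }
  have hg : ∀ x : v.adicCompletion K,
      x ∈ (Submodule.span (v.adicCompletionIntegers K) {(1 : v.adicCompletion K)}).toAddSubgroup → g x = 0 := by
    intro x hx
    rw [Submodule.mem_toAddSubgroup, Submodule.mem_span_singleton] at hx
    obtain ⟨a, rfl⟩ := hx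
    change GreenbergSelmer.cofreeMk (padicCoeffField S) θ (fun _ => ⟨f₀ (a • (1 : v.adicCompletion K)), hF _⟩) = 0
    rw [← LinearMap.mem_ker, GreenbergSelmer.ker_cofreeMk]
    have ha : a • (1 : v.adicCompletion K) = ((a : v.adicCompletion K)) := by rw [Algebra.smul_def, mul_one]; rfl
    simp only [ha]
    exact transportVec_mem_lattice f₀ hF hO a
  refine ⟨QuotientAddGroup.lift _ g hg, fun x => ?_⟩
  exact QuotientAddGroup.lift_mk' _ hg x

variable {θ f₀ hF}

/-- **`f̄₀` is `f₀`-semilinear**: `f̄₀(c • q) = f₀(c) • f̄₀(q)` for `c ∈ 𝒪_{K_v}` (the `𝒪_{ℚ_p(S)}`-module structure of `Cofree`).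
[cite: EmertonPollackWeston2006, §3.1 (arXiv:math/0404484 p. 17)] -/
theorem transportHom_smul (hO : ∀ y : v.adicCompletionIntegers K, f₀ (y : v.adicCompletion K) ∈ padicCoeffIntegers S)
    (fb : (v.adicCompletion K ⧸ Submodule.span (v.adicCompletionIntegers K) {(1 : v.adicCompletion K)}) →+
      GreenbergSelmer.Cofree θ (padicCoeffField S))
    (hfb : ∀ x : v.adicCompletion K,
      fb (Submodule.Quotient.mk x) = GreenbergSelmer.cofreeMk (padicCoeffField S) θ (fun _ => ⟨f₀ x, hF x⟩))
    (c : v.adicCompletionIntegers K)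
    (q : v.adicCompletion K ⧸ Submodule.span (v.adicCompletionIntegers K) {(1 : v.adicCompletion K)}) :
    fb (c • q) = (⟨f₀ (c : v.adicCompletion K), hO c⟩ : padicCoeffIntegers S) • fb q := by
  obtain ⟨x, rfl⟩ := Submodule.Quotient.mk_surjective _ q
  rw [← Submodule.Quotient.mk_smul, hfb, hfb, ← map_smul]
  congr 1
  funext i
  apply Subtype.ext
  change f₀ (c • x) = ((⟨f₀ (c : v.adicCompletion K), hO c⟩ : padicCoeffIntegers S) • (⟨f₀ x, hF x⟩ : padicCoeffField S) :
    padicCoeffField S)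
  rw [Algebra.smul_def, Algebra.smul_def, map_mul]
  rfl

/-- **M3: the transport `j = f̄₀ ∘ α` is equivariant for the decomposition group** when `α` is `χW`-equivariant and
`θ(res δ)₀₀ = f₀(χW δ)` (character identification): both sides are the scalar `f₀(χW δ)` on `(F/𝒪)(θ)` (`smul_cofreeMk_of_rank_one`).
[cite: EmertonPollackWeston2006, §3.1 (arXiv:math/0404484 p. 17)] -/
theorem transport_equivariant (hO : ∀ y : v.adicCompletionIntegers K, f₀ (y : v.adicCompletion K) ∈ padicCoeffIntegers S) (W : WeierstrassCurve ℚ)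
    (fb : (v.adicCompletion K ⧸ Submodule.span (v.adicCompletionIntegers K) {(1 : v.adicCompletion K)}) →+
      GreenbergSelmer.Cofree θ (padicCoeffField S))
    (hfb : ∀ x : v.adicCompletion K,
      fb (Submodule.Quotient.mk x) = GreenbergSelmer.cofreeMk (padicCoeffField S) θ (fun _ => ⟨f₀ x, hF x⟩))
    (α : (W.baseChange K).geomPrimaryTorsion p →+
      (v.adicCompletion K ⧸ Submodule.span (v.adicCompletionIntegers K) {(1 : v.adicCompletion K)}))
    (χW : absoluteGaloisGroup (v.adicCompletion K) →* (v.adicCompletionIntegers K)ˣ)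
    (hα : ∀ (δ : absoluteGaloisGroup (v.adicCompletion K)) (t : (W.baseChange K).geomPrimaryTorsion p),
      α (resGalOfEmb (closureEmb (K := K) (v.adicCompletion K)) δ • t) = (χW δ : v.adicCompletionIntegers K) • α t)
    (hθχ : ∀ δ : absoluteGaloisGroup (v.adicCompletion K),
      ((((θ (resGalOfEmb (closureEmb (K := K) (v.adicCompletion K)) δ) : GL (Fin 1) (padicCoeffIntegers S)) :
          Matrix (Fin 1) (Fin 1) (padicCoeffIntegers S)) 0 0 : padicCoeffIntegers S) : PadicAlgCl p) =
        f₀ (((χW δ) : v.adicCompletionIntegers K) : v.adicCompletion K))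
    (δ : absoluteGaloisGroup (v.adicCompletion K)) (t : (W.baseChange K).geomPrimaryTorsion p) :
    fb (α (resGalOfEmb (closureEmb (K := K) (v.adicCompletion K)) δ • t)) =
      resGalOfEmb (closureEmb (K := K) (v.adicCompletion K)) δ • fb (α t) := by
  rw [hα, transportHom_smul hO fb hfb]
  obtain ⟨z, hz⟩ := GreenbergSelmer.cofreeMk_surjective (padicCoeffField S) θ (fb (α t))
  rw [← hz, smul_cofreeMk_of_rank_one]
  congr 1
  apply Subtype.ext
  exact (hθχ δ).symm

/-- **M4: the `𝒪_{ℚ_p(S)}`-span of the range of `j = f̄₀ ∘ α` is everything** when `α` is surjective: every class of `(F/𝒪)(θ)` is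
`(pᵏx) • (p^{-k} mod 𝒪)` with `pᵏx ∈ 𝒪`, and `p^{-k} mod 𝒪 = f̄₀(p^{-k} mod 𝒪_{K_v})` is in the range. [cite: Greenberg1989, §1 p. 98] -/
theorem span_range_transport_eq_top (W : WeierstrassCurve ℚ)
    (fb : (v.adicCompletion K ⧸ Submodule.span (v.adicCompletionIntegers K) {(1 : v.adicCompletion K)}) →+
      GreenbergSelmer.Cofree θ (padicCoeffField S))
    (hfb : ∀ x : v.adicCompletion K,
      fb (Submodule.Quotient.mk x) = GreenbergSelmer.cofreeMk (padicCoeffField S) θ (fun _ => ⟨f₀ x, hF x⟩))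
    (α : (W.baseChange K).geomPrimaryTorsion p →+
      (v.adicCompletion K ⧸ Submodule.span (v.adicCompletionIntegers K) {(1 : v.adicCompletion K)}))
    (hα : Function.Surjective α) :
    Submodule.span (padicCoeffIntegers S) (Set.range (fb.comp α)) = ⊤ := by
  rw [eq_top_iff]
  rintro c -
  obtain ⟨x, rfl⟩ := GreenbergSelmer.cofreeMk_surjective (padicCoeffField S) θ c
  obtain ⟨k, hk⟩ := GreenbergSelmer.exists_pow_mul_norm_le_one S x
  have hp0 : (p : PadicAlgCl p) ≠ 0 := Nat.cast_ne_zero.mpr (Fact.out : p.Prime).ne_zero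
  -- the scalar `a = pᵏ x₀ ∈ 𝒪` and the vector `e = (p^{-k})`
  set a : padicCoeffIntegers S :=
    ⟨(p : PadicAlgCl p) ^ k * (x 0 : PadicAlgCl p), mul_mem (pow_mem (natCast_mem _ p) k) (x 0).2, hk 0⟩ with ha
  have hy : f₀ (((p : v.adicCompletion K) ^ k)⁻¹) = ((p : PadicAlgCl p) ^ k)⁻¹ := by
    rw [map_inv₀, map_pow, map_natCast]
  have hx : x = a • fun _ : Fin 1 => (⟨f₀ (((p : v.adicCompletion K) ^ k)⁻¹), hF _⟩ : padicCoeffField S) := by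
    funext i
    apply Subtype.ext
    rw [Fin.eq_zero i, Pi.smul_apply]
    change (x 0 : PadicAlgCl p) = ((a • (⟨f₀ (((p : v.adicCompletion K) ^ k)⁻¹), hF _⟩ : padicCoeffField S) :
      padicCoeffField S) : PadicAlgCl p)
    rw [Algebra.smul_def]
    change (x 0 : PadicAlgCl p) = ((p : PadicAlgCl p) ^ k * (x 0 : PadicAlgCl p)) * f₀ (((p : v.adicCompletion K) ^ k)⁻¹)
    rw [hy, mul_comm ((p : PadicAlgCl p) ^ k) _, mul_assoc, mul_inv_cancel₀ (pow_ne_zero k hp0), mul_one]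
  obtain ⟨t, ht⟩ := hα (Submodule.Quotient.mk (((p : v.adicCompletion K) ^ k)⁻¹))
  rw [hx, map_smul]
  refine Submodule.smul_mem _ a (Submodule.subset_span ⟨t, ?_⟩)
  rw [AddMonoidHom.comp_apply, ht, hfb]

end Transport

end Summit.BirchSwinnertonDyer.BirchSwinnertonDyer.Theorems.SmallImageRttCharRoad

end
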